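import Summits.Ventures.HSemireg.S4BridgeWeilReductions
import Summits.HodgeConjecture.HodgeConjecture.Theorems.Ring2ClassTargetsRows
import HarnessLib

/-!
# Venture HSemireg · TRACK «S4-PUSH» (iii), bridge (B3), scopes (a)/(b) with MOONEN–ZARHIN'S THEOREMS BY NAME:
# «HC for abelian varieties of dimension ≤ 5 (resp. fourfolds) ⇐ Weil classes on abelian fourfolds (resp. split
# sixfolds)» modulo EXACTLY Math. Ann. 315 Thm. 0.1 / Thm. 0.2 (codimension-2 parts), as printed

HONEST FRAMING (page 1 of every file of the cell `pub-hsemireg`). A WIRING / CITATION-RECORD file: NO definition, NO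
new named fact, NO `sorry`; every arrow is a theorem ALREADY in the tree (ring 2's atlas rows
`Ring2.ClassTargets.hcAtDim_four_of_weilClassesFourfolds` / `hcUpToDim_five_of_codimTwoFacts_of_weilClassesFourfolds` /
`hcUpToDim_five_iff_weilClassesFourfolds`, and `HodgeTheory.…_of_codimTwoFacts` of
`Literature/…/AbelianLowDimensionWeilReductionProofs.lean`), re-exposed in the cell's currency with the printed
sentence it types. NOTHING here says or implies that HC, HC_CM or HC_AV is proved: `HodgeConjectureFor` occurs only to
the right of a displayed Weil-class HYPOTHESIS and of Moonen–Zarhin's theorems taken BY NAME (named facts of the tree,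
refereed in print, NOT proved in the tree), or to the LEFT of an arrow (the on-path converse). Seat s4-bridge-3
(prover, gen 2; citation records revised gen 3 — statements and proofs unchanged), 2026-08-23. Sequel of `S4BridgeWeilReductions.lean` (same namespace), answering the S4 referee's
precision P-2 (`s4push/VERDICT-B3-TYPING-s4-bridge-3-2026-08-23.md`): there, scopes (a)/(b) carry ONE binder
`hMZ : MoonenZarhin1999_hodgeClasses_abelian_dim_le_five_of_weilClassesFourfolds` whose NAME says Moonen–Zarhin but whose
CONTENT is the printed COMBINED sentence «Weil classes on abelian fourfolds ⟹ HC in dimension ≤ 5» (Markman,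
arXiv:2509.23403 §1.1 «Combining these results with Theorem 1.2 we get: Corollary 1.3»; Voisin, Sém. Bourbaki
Exp. 1248 Cor. 2.8). HERE the binders are LITERALLY Moonen–Zarhin's two printed theorems, in the codimension-2 form in
which the tree vendored them VERBATIM as named facts (`Literature/…/AbelianLowDimensionCodimTwoHodgeClasses.lean`):

* `h01 : MoonenZarhin1999_codimTwoHodgeClasses_abelianFourfold` — Math. Ann. 315 (1999) THM. 0.1, codimension 2: on
  every complex abelian FOURFOLD `X`, `B²(X) ⊆ D²(X) + Σ_k W_k` (rational `(2,2)` classes lie in the span of products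
  of divisor classes and of the rational `(2,2)` Weil classes `weilClassesOf X φ 2 d`, `φ ≫ φ = -d`). As printed
  (arXiv:math/9901113, from p. 1 on in v1 as in v2 — Math. Ann. «pp. 711–712» is INFERRED from the article's first page, print not held;
  parts PRINTED (i)–(iv) in BOTH arXiv versions — read by eye on the v1 PDF by seat s4-bridge-lit g3,
  `s4push/BRIDGE-LIT-ASPRINTED.md` v1.5, and on the v1 and v2 PDFs by lit-3 g29, `HOME/lit/MZ99-ARXIV-V1-V2-NUMBERING-lit3.md`;
  the held corpus text (= the TeX source of v2) renumbers them (1)–(4) and elides the statement numbers — extraction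
  artefacts; «Theorem 0.1» per Voisin Exp. 1248 Thm. 2.6 and Markman's siglum [MZ3]): «Theorem. Let X be a
  complex abelian variety with dim(X) ≤ 4. … (i) Suppose we are in case (a) or (b). Then the Hodge ring B•(X) is
  generated by the subalgebra D•(X) of divisor classes together with the space of Weil classes W_k ⊂ B²(X). … (ii)
  Suppose we are in case (c). Then … B•(X) is generated by the divisor classes together with the spaces of Weil classes
  W_k ⊂ B²(X), where k runs through the set of imaginary quadratic fields contained in D. (iii) Suppose we are in case
  (d). Then … B•(X) = D•(X). … (iv) Suppose we are not in one of the cases (a), (b), (c) or (d). Then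
  Hg(X) = Sp_D(V,φ) and B•(Xⁿ) = D•(Xⁿ) for all n.» — so EVERY abelian fourfold is covered.
* `h02 : MoonenZarhin1999_codimTwoHodgeClasses_abelianFivefold` — THM. 0.2, codimension 2: on every complex abelian
  FIVEFOLD `X`, `B²(X) ⊆ D²(X) + Σ_α α^* B²(X')` over the surjective homomorphisms `α : X ↠ X'` onto abelian
  FOURFOLDS. As printed (from arXiv p. 2 on, in v1 as in v2; store text p0001.txt L144 – p0002.txt L13; Math. Ann. «pp. 712–713» inferred,
  print not held): «Theorem. Let X be a complex abelian
  variety of dimension 5. … (i) Suppose we are in case (e). Consider the space of Weil classes W_k ⊂ B²(X₁ × X₂) and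
  write W_{k,α} ⊂ B²(X) for its image under the map B²(X₁ × X₂) → B²(X) induced by a surjective homomorphism
  α : X → X₁ × X₂. Then the Hodge ring B•(X) is generated by the subalgebra D•(X) of divisor classes together with the
  subspaces W_{k,α}. … (ii) … case (f) … B•(Xⁿ) is generated by the images of B•(X₀ⁿ) and B•(X₁ⁿ × X₂ⁿ) … (iv) …
  B•(Xⁿ) is generated by the images of the Hodge rings B•(Y_j^{m_j}). In particular, if X has no simple factor of dimension 4
  then … B•(Xⁿ) = D•(Xⁿ)»; after Thm. (0.2) (store text p0002.txt L11–14): «in the cases (e) and (f) the pull-backs of the Weil classes are needed to generate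
  the Hodge ring of X; in these cases we have D²(X) ≠ B²(X) and D³(X) ≠ B³(X)».
  C. Voisin, Sém. Bourbaki Exp. 1248, p. 15, the one-sentence form of both: «Théorème 2.6 (Moonen et Zarhin, 1999,
  Theorem 0.1 et Theorem 0.2) Soit X une variété abélienne sur ℂ, avec dim X ≤ 5. Alors la ℚ-algèbre des classes de
  Hodge rationnelles de X est engendrée par les classes de Hodge de degré 2 et par des classes de Weil sur certains
  facteurs de X admettant un endomorphisme quadratique.»

AS-PRINTED DELTAS, NAMED (never silent):
(Δ1) Thms. 0.1/0.2 generate the whole Hodge RING; `h01`/`h02` are their CODIMENSION-2 parts only — IMPLIED by print,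
  so every arrow below is typed with WEAKER-OR-EQUAL hypotheses than the printed reduction (the safe direction: fed
  with the printed theorems it returns the printed conclusion). The other codimensions are routed in the tree through
  Lefschetz `(1,1)` (`lefschetzOneOne_rational_holds`), hard Lefschetz (`nonempty_hardLefschetzNFold_holds`), Hodge
  models (`nonempty_hodgeModel_holds`), `D² ⊆ N²` (`AbelianVariety.divisorClassesSpan_le_algebraicClasses`), pull-back
  of algebraic classes and HC in dimension `≤ 3` — all THEOREMS of the tree (module docstring of
  `AbelianLowDimensionWeilReductionProofs`: «routing the degrees above the middle through hard Lefschetz instead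
  consumes only the codimension-2 parts of Thms. 0.1–0.2»); print instead uses ring generation and «intersections of
  algebraic cycles are algebraic».
(Δ2) For FOURFOLDS Markman's printed second step (arXiv:2502.03415v2 p. 9 L24–36) cites «[MZ1, Theorem 2.11]» (simple
  fourfolds: «H^{2,2}(A, ℚ) is spanned by quadratic polynomials in divisor classes and by Hodge-Weil classes (for
  possibly infinitely many complex multiplications)»), isogeny invariance, «[R, Theorem 4.11]» (product of two abelian
  surfaces: HC outright) and «[MZ3, Prop. 3.8]» / «[MZ3, Theorem 0.1(i)]» (`B × E`); the tree's binder is instead the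
  codimension-2 part of [MZ3] = Thm. 0.1 over ALL fourfolds (its part (iv) covers the products of surfaces), ONE
  refereed theorem («(3.8) Proposition», arXiv v2 p. 12 = v1 p. 8 (same number in both versions), is AS PRINTED a
  Hodge-GROUP dichotomy for `X × E`, `Hom(E, X) = 0` — quoted in the sibling file —; the ring conclusion of Markman's
  first alternative is (0.1)(iv) — s4-bridge-lit g3, s4-ref g4). Typed reading: «Cor. 1.6.1 ⇐ Thm. 1.5.1 ∧ [MZ3, Thm. 0.1 (codim 2)]» — Moonen–Zarhin AS PRINTED,
  not Markman's exact triple of citations (whose union gives HC in dimension 4 from the Weil classes but is not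
  literally `h01` on surface products). Recorded, not adjudicated.
(Δ3) NOTE to Thm. 0.1 (iii): for `Hg(X)` a ℚ-form of `SL₂³` «there are exceptional Hodge classes in B²(X²) … not of Weil
  type» — the printed reduction is for `X` of dimension ≤ 5, not for powers; nothing here speaks about `dim ≥ 6`.
STATUS: Moonen–Zarhin 1999 REFEREED (Math. Ann.); Markman's Thm. 1.5.1 / Cor. 1.6.1 / Thm. 1.2 / Cor. 1.3 PREPRINTS (the
tree tags the fourfold statement `Markman2025_weilClasses_algebraic_abelianFourfold` as a claim; refereed for
discriminant 1, JEMS 25 (2023), and for `ℚ(√-3)` / `ℚ(√-1)` via Schoen 1998 / Koike 2004); Voisin Exp. 1248 an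
expert exposition; the journal survey Voisin, J. Open Math. Probl. 1 (1) (2025) 16–51 (the publisher's offprint prints
«Received 9 Jan 2025; Revised 4 Jun 2025; Accepted 13 Jul 2025» — an editorial cycle; «refereed» is a reading of that
line, not a printed word), §3.3 «Weil Hodge classes on Weil abelian varieties», printed p. 33 = offprint PDF p. 20
(printed page = PDF page + 13; held store text p0020.txt L29–38, the offprint's PyMuPDF text L31–40), read ×2 ACROSS
SEATS — s4-bridge-lit g3 on the store text, lit-3 g30 BY EYE on the author-hosted offprint
(`HOME/lit/VOISIN2025-JOMP-P33-STATUS-SENTENCE-BYEYE-x2-lit3.md`; s4-ref g4 P-2 closed) —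
prints the whole chain of scope (a) as a status sentence («Zharhin» [sic], as printed; the reference list prints
«Yu. Zarhin»): «Moonen and Zharhin [MZ95] proved that, in the case of
abelian fourfolds, the Hodge conjecture reduces to the Hodge conjecture on Weil abelian fourfolds. More precisely,
their algebra of Hodge classes is generated by degree 2 Hodge classes and Weil type Hodge classes. … Finally, Markman
[Mar25] proved recently by a completely different method the Hodge conjecture for Weil abelian 6-folds of discriminant
1. By a specialization argument, this implies the Hodge conjecture for Weil abelian 4-folds of any discriminant, and
thus the Hodge conjecture for all abelian fourfolds by [MZ95], which is a remarkable achievement.» (her [MZ95] =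
Duke 77; the non-simple fourfolds are [MZ3] = Math. Ann. 315 in Markman's own proof). The Weil-class hypotheses are displayed in the cell's currency exactly as in the sibling file:
`∀ d ≥ 1, EStepSecantInduction.WeilAlgebraicAll 2 d` (`= Markman2025_weilClasses_algebraic_abelianFourfold`, kernel
`weilAlgebraicAll_two_iff_markman`) and `∀ d ≥ 1, Stubs.WeilAlgebraicSplitHyperplane 3 d` (= Thm. 1.5.1 as recorded,
kernel `weilAlgebraicSplitHyperplane_three_iff_markman`). The sibling's binder follows from the two here:
`HodgeTheory.MoonenZarhin1999_hodgeClasses_abelian_dim_le_five_of_weilClassesFourfolds_of_codimTwoFacts h01 h02`.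

## References

* [MoonenZarhin1999LowDim] B. Moonen, Yu. Zarhin, Math. Ann. 315 (1999) 711–733 = arXiv:math/9901113 (v1 26 Jan 1999,
  14 pp.; v2 «last revised 13 Apr 1999», 21 pp. = the latest author version and the TeX source behind the held store
  text): Thm. (0.1) (from arXiv p. 1, parts (i)–(iv)), Thm. (0.2) (from arXiv p. 2, parts (i)–(iv)), (1.4) (Hodge ring
  `B•`, divisor classes `D•`), (1.9) (Weil classes `W_K`; = item (1.8) of arXiv v1 — v2 inserts a new (1.5), so v1
  (1.5)–(1.8) = v2 (1.6)–(1.9); NOTHING ELSE is renumbered), (2.7) (Tankeev's theorem, same number in both versions),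
  «(3.8) Proposition» (arXiv v2 p. 12 = v1 p. 8), §5 (5.11)–(5.12) ((5.12): «Part (iv) … using (0.1) and (2.7)»). THIS
  FILE USES THE arXiv v2 NUMBERS, which are also those of the tree's fact files `AbelianLowDimensionWeilReduction` /
  `AbelianLowDimensionCodimTwoHodgeClasses` («(1.9)» there is v2-correct) and of the store text; the one exception is
  that fact file's «Thm. 0.2 with (2.8) and §5 (5.11)»: there is NO item (2.8) in either arXiv version — a locator slip
  for, most plausibly, (2.7) (cf. (5.12)), recorded by lit-3 g29 for that file's owner; this file writes (2.7). The
  Math. Ann. PRINT is not held: its item numbering is unverified (and not needed — v2 is the latest author version) and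
  «pp. 711–713» for §0 is an inference from the article's first page. Concordance of both arXiv versions, item by
  item, hand-checked: `HOME/lit/MZ99-ARXIV-V1-V2-NUMBERING-lit3.md` + carrier `HOME/lit/MoonenZarhin1999-arXiv-v1v2-lit3/`
  (lit-3 g29; ×2 s4-bridge-lit g4, who withdrew the earlier «arXiv v1 numbering (1.8) … the tree's (1.9) possibly the
  Math. Ann. numbering» reading that this file's previous revision carried). Thm. (0.1) (iii) prints «ℬ•(Xⁿ) = ℬ•(Xⁿ)»
  [sic, read 𝒟•(Xⁿ)] in both arXiv versions.
* [Markman2025SecantWeil] E. Markman, arXiv:2502.03415v2, Thm. 1.5.1 (p. 9 L7–13), Cor. 1.6.1 with proof (p. 9 L17–36). PREPRINT.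
* [Markman2025SurveySecant] E. Markman, arXiv:2509.23403v2, §1.1 Thm. 1.2 (p. 3 L20–22), reduction paragraph (L38–46),
  Cor. 1.3 (L47); Abstract (p. 1 L35–37) — UNREFEREED preprint numbering; published sibling [Markman2026ICMSecant] =
  Proc. ICM 2026, Vol. 3 (SIAM), 586–602 (invited-lecture restatement; published pagination not held).
* [Voisin2026BourbakiMarkman] C. Voisin, Sém. Bourbaki Exp. 1248, Thm. 2.6 and Cor. 2.8 (p. 15), Lemme 2.9 and
  Cor. 2.10 (p. 16) — expert exposition (author's PDF).
* [MoonenZarhin1995Duke] Duke Math. J. 77 (1995) 553–581, Thm. 2.11 — as cited in [Markman2025SecantWeil] v2 p. 9; not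
  held (no open version; acq-04933 cite-only); CONTENT through the held secondary [Gordon1999HodgeAVSurvey] Thm. 5.2
  «([B.75] Thm.2.12)» (arXiv:alg-geom/9709030, TeX chunk p0016 L67–77; [B.75] = this Duke paper, chunk p0034 L170–176;
  flag NN-1, s4-bridge-lit g20 (R35); read ×2 by s4-bridge-3 g32): for a simple abelian fourfold A, Hdg²(A) = Div²(A) +
  Σ_K ⋀⁴_K H¹(A, ℚ), K over the imaginary quadratic subfields of End⁰(A) acting on A with multiplicities (2,2) —
  Markman's «Theorem 2.11» and Gordon's «Thm.2.12» name this one statement (which number slipped is undecidable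
  without the primary; details in the prequel's References). [RamonMari2008] Collect. Math. 59 (1) (2008) 1–26 — HELD (open access at RACO; store
  `paper:url-946b667c446a`, PDF page = printed page; read by s4-bridge-lit g19 (R34), ×2 by s4-bridge-3 g30): Thm. 4.11,
  p. 22 L29–31 (the item of Markman's «[R, Theorem 4.11]», v2 p. 9; = arXiv:math/0505357 Thm. 2.14): the Hodge conjecture
  for S₁ × S₂ with p_g(S_i) = 1, q(S_i) = 2 — two abelian surfaces are such —, proved (L36) via Thm. 3.15, p. 14 L14–22
  (products of simple abelian surfaces ∕ elliptic curves with Hom(A_i, A_j) = 0: Hg of the product = product of the Hg;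
  = the published form of arXiv Prop. 2.18 «Let A_i be abelian varieties of dimension 1 or 2. Then the Hodge conjecture
  holds for A_1 × ⋯ × A_r …»; print has NO item 2.18 — the earlier gloss «Thm. 4.11 = arXiv Prop. 2.18» was MM-1).
  Verbatim printed statements: the sibling file's References.
* [Schoen1998HodgeWeilAddendum] C. Schoen, Compositio Math. 114 (1998) 329–336, ¶10 «PROPOSITION» (p. 332).
* [Voisin2025GHCConiveauSurvey] C. Voisin, J. Open Math. Probl. 1 (1) (2025) 16–51 (doi 10.56994/jomp.001.001.002;
  received 9 Jan / revised 4 Jun / accepted 13 Jul 2025), §3.3, printed p. 33 = offprint PDF p. 20 (status sentence of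
  scope (a); read ×2 across seats, STATUS above).
* [Deligne1982HodgeCycles] P. Deligne (notes by J. S. Milne), LNM 900, §4 Prop. 4.4 (Weil classes are Hodge classes).
-/

noncomputable section

open CategoryTheory

namespace Summit.Ventures.HSemireg.S4Bridge

open Literature.AlgebraicGeometry Literature.AlgebraicGeometry.Motives Literature.AlgebraicGeometry.HodgeTheory
open Literature.AlgebraicTopology.SingularHomology
open Summit.HodgeConjecture.HodgeConjecture.Cruxes.HodgeAbelianVarieties.EStepSecantInduction (WeilAlgebraicAll)
open Summit.HodgeConjecture.HodgeConjecture.Cruxes.HodgeAbelianVarieties.EStepSecantInduction.Stubs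
  (WeilAlgebraicSplitHyperplane)
open Summit.HodgeConjecture.HodgeConjecture.Cruxes.HodgeAbelianVarieties.PrymCanonicalZ3SplitSeeds.Stubs.WeilSectorOffReach
  (weilAlgebraicAll_two_iff_markman)
open Summit.HodgeConjecture.HodgeConjecture.Ring2.ClassTargets
  (hcAtDim_four_of_weilClassesFourfolds weilClassesFourfolds_of_hcAtDim_four
    hcUpToDim_five_of_codimTwoFacts_of_weilClassesFourfolds hcUpToDim_five_iff_weilClassesFourfolds)

/-! ### Scope (a) with [MZ3, Thm. 0.1] BY NAME: abelian FOURFOLDS -/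

/-- **(B3-a, Moonen–Zarhin AS PRINTED) — HC for every complex abelian FOURFOLD ⇐ the Weil classes of abelian
fourfolds, modulo EXACTLY Moonen–Zarhin 1999 Thm. 0.1 (codimension-2 part, named fact `h01`).** Printed sentences
typed: Markman, arXiv:2502.03415v2 p. 9 L24–36 (second step of the proof of Cor. 1.6.1): «If A is a simple abelian
fourfold, then H^{2,2}(A, ℚ) is spanned by quadratic polynomials in divisor classes and by Hodge-Weil classes (for
possibly infinitely many complex multiplications), by [MZ1, Theorem 2.11]. The Hodge conjecture for abelian fourfolds
is thus reduced to the case of non-simple abelian fourfolds. If the Hodge conjecture is verified for an abelian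
variety, then it follows for any isogenous abelian variety. The Hodge conjecture for the product of two abelian
surfaces was proved in [R, Theorem 4.11]. If A = B × E, where B is a simple abelian 3-fold and E is an elliptic curve,
then either the Hodge ring is generated by divisor classes, or E and B both have complex multiplication by the same
imaginary quadratic number field K, by [MZ3, Prop. 3.8], and in the latter case the Hodge ring of A is generated by
divisor classes and Hodge-Weil classes, by [MZ3, Theorem 0.1(i)].»; Moonen–Zarhin, Math. Ann. 315 Thm. 0.1 (module
docstring, verbatim). Typing: HYPOTHESIS displayed in the cell's currency — for every `d ≥ 1`, every rational `(2,2)`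
class of the Weil plane of every `√-d`-Weil fourfold is algebraic (`WeilAlgebraicAll 2 d`); `h01` BY NAME; conclusion
`HodgeConjectureFor A.dim A.X` for every complex abelian `A` with `A.dim = 4`. Carrier: ring 2's kernel theorem
`Ring2.ClassTargets.hcAtDim_four_of_weilClassesFourfolds` (codimension 0 trivial, 1 Lefschetz `(1,1)`, 2 = `h01` +
the hypothesis + `D² ⊆ N²`, 3–4 by hard Lefschetz; Hodge models exist — all tree theorems). Deltas (Δ1)/(Δ2) of the
module docstring apply: hypotheses WEAKER-OR-EQUAL than print (codimension-2 slice of Thm. 0.1), binder = [MZ3]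
Thm. 0.1 over all fourfolds rather than Markman's triple [MZ1, 2.11] + [R, 4.11] + [MZ3, 3.8 / 0.1(i)] — named, not
silent. CONDITIONAL on `h01` (refereed, unproved in the tree) and on the displayed Weil-class hypothesis (a PREPRINT
claim in general); no case of HC is proved here.
[cite: MoonenZarhin1999LowDim, Thm. 0.1 with (1.4) and (1.9) (arXiv:math/9901113, from p. 1; arXiv v2 numbering, (1.9) = (1.8) of v1)]
[cite: Markman2025SecantWeil, Cor. 1.6.1, proof, second step (arXiv v2 p. 9 L24–36)]
[cite: MoonenZarhin1995Duke, Thm. 2.11 (as cited in Markman2025SecantWeil, v2 p. 9; the same statement is «[B.75] Thm.2.12» in Gordon1999HodgeAVSurvey, Thm. 5.2, held as arXiv:alg-geom/9709030; primary not held)]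
[cite: RamonMari2008, Thm. 4.11, p. 22 (as cited in Markman2025SecantWeil, v2 p. 9; = arXiv:math/0505357 Thm. 2.14) with Thm. 3.15, p. 14 (= arXiv Prop. 2.18)] -/
theorem hodgeConjectureFor_dim_four_of_weilAlgebraicAll_two_of_moonenZarhin
    (h01 : MoonenZarhin1999_codimTwoHodgeClasses_abelianFourfold)
    (hW₄ : ∀ d : ℕ, 0 < d → WeilAlgebraicAll 2 d) (A : AbelianVariety ℂ) (hd : A.dim = 4) :
    HodgeConjectureFor A.dim A.X :=
  hcAtDim_four_of_weilClassesFourfolds h01 (weilAlgebraicAll_two_iff_markman.1 hW₄) A hd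

/-- **(B3-a, AS PRINTED end to end) — «Corollary 1.6.1. The Hodge conjecture holds for abelian fourfolds», «a known
consequence of Theorem 1.5.1», modulo EXACTLY [MZ3, Thm. 0.1] (codimension-2 part) BY NAME** (Markman,
arXiv:2502.03415v2 §1.6 p. 9: L17–18, Cor. 1.6.1 = L19, proof L20–36; Thm. 1.5.1 = L7–13 «Let d be a positive
integer. Set K := ℚ(√−d). The Hodge-Weil classes of polarized abelian sixfolds of Weil type with complex
multiplication by K and with discriminant −1 are algebraic.» — PREPRINT). Typing: HYPOTHESIS = Thm. 1.5.1 displayed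
per `d` in the `K`-symmetrised convention (`∀ d ≥ 1, Stubs.WeilAlgebraicSplitHyperplane 3 d`); FIRST printed step
«by degenerating abelian sixfolds of Weil type of discriminant −1 to products of abelian fourfolds of Weil type of
arbitrary discriminant and abelian surfaces of Weil type [S2, Prop. 10]» = the tree's KERNEL theorem
`weilAlgebraicAll_two_of_splitSixfolds` (sibling file; Voisin Exp. 1248 Cor. 2.10, p. 16: «Le corps K étant donné,
la conjecture de Hodge pour les classes de Weil sur les variétés abéliennes de Weil pour le corps K, de dimension 6 et
de discriminant 1, entraîne la conjecture de Hodge pour les classes de Weil sur les variétés abéliennes de Weil pour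
le corps K, de dimension 4 et de discriminant arbitraire»); SECOND printed step = `h01` BY NAME
(`hodgeConjectureFor_dim_four_of_weilAlgebraicAll_two_of_moonenZarhin`). Conclusion `HodgeConjectureFor A.dim A.X`
for every complex abelian FOURFOLD. Versus the sibling's `hodgeConjectureFor_dim_four_of_splitSixfolds`: the binder
`hMZ` (the combined reduction SENTENCE, which also speaks about dimension 5) is replaced by Moonen–Zarhin's Thm. 0.1
itself (codimension-2 part) — nothing about fivefolds is assumed. Deltas (Δ1)/(Δ2) named in the module docstring.
CONDITIONAL on `h01` and on Thm. 1.5.1 (PREPRINT); no case of HC is proved here. Refereed status sentence of the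
whole chain: Voisin, J. Open Math. Probl. 1 (2025) p. 33 «… 6-folds of discriminant 1. By a specialization argument,
this implies the Hodge conjecture for Weil abelian 4-folds of any discriminant, and thus the Hodge conjecture for all
abelian fourfolds by [MZ95]» (module docstring, STATUS).
[cite: Markman2025SecantWeil, Thm. 1.5.1 and Cor. 1.6.1 with proof (arXiv v2 p. 9 L7–36)]
[cite: MoonenZarhin1999LowDim, Thm. 0.1 (arXiv:math/9901113, from p. 1)] [cite: Schoen1998HodgeWeilAddendum, 10 (Proposition), p. 332]
[cite: Voisin2026BourbakiMarkman, Cor. 2.10 (p. 16)] [cite: Voisin2025GHCConiveauSurvey, §3.3 p. 33] -/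
theorem hodgeConjectureFor_dim_four_of_splitSixfolds_of_moonenZarhin
    (h01 : MoonenZarhin1999_codimTwoHodgeClasses_abelianFourfold)
    (hW₆ : ∀ d : ℕ, 0 < d → WeilAlgebraicSplitHyperplane 3 d) (A : AbelianVariety ℂ) (hd : A.dim = 4) :
    HodgeConjectureFor A.dim A.X :=
  hodgeConjectureFor_dim_four_of_weilAlgebraicAll_two_of_moonenZarhin h01
    (fun d hd' ↦ weilAlgebraicAll_two_of_splitSixfolds hd' (hW₆ d hd')) A hd

/-! ### Scope (b) with [MZ99, Thms. 0.1 and 0.2] BY NAME: dimension `≤ 5` -/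

/-- **(B3-b, Moonen–Zarhin AS PRINTED) — «La conjecture de Hodge pour les variétés abéliennes de dimension au plus 5
est entraînée par la conjecture de Hodge pour les classes de Weil sur les variétés abéliennes de Weil de dimension
≤ 4» (Voisin, Sém. Bourbaki Exp. 1248, Cor. 2.8, p. 15, from her Thm. 2.6 = «Moonen et Zarhin, 1999, Theorem 0.1 et
Theorem 0.2»); = Markman, arXiv:2509.23403v2 p. 3 L38–47 «… If X is a non-simple abelian variety of dimension 5,
then the Hodge ring of X is generated by divisor classes and pull backs of Weil classes from quotient abelian
fourfolds, by [MZ2, Theorem 0.2]. Combining these results with Theorem 1.2 we get: Corollary 1.3. The Hodge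
conjecture holds for abelian varieties of dimension ≤ 5.» — modulo EXACTLY Thm. 0.1 (`h01`) and Thm. 0.2 (`h02`),
codimension-2 parts, BY NAME.** Typing: HYPOTHESIS displayed in the cell's currency (`∀ d ≥ 1, WeilAlgebraicAll 2 d`:
the rational `(2,2)` Weil classes of every `√-d`-Weil fourfold, every `d` — «les classes de Weil sur les variétés
abéliennes de Weil de dimension ≤ 4»: dimension 2 is Lefschetz `(1,1)`, so dimension 4 is the whole hypothesis);
`h01`, `h02` BY NAME; conclusion `HodgeConjectureFor A.dim A.X` for every complex abelian `A` with `A.dim ≤ 5`.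
Carrier: ring 2's kernel theorem `Ring2.ClassTargets.hcUpToDim_five_of_codimTwoFacts_of_weilClassesFourfolds` (=
`HodgeTheory.Markman2025_hodgeClasses_algebraic_abelian_dim_le_five_of_codimTwoFacts` + Hodge models; the fivefold
step pulls `B²` of fourfold QUOTIENTS back, `mem_algebraicClasses_two_of_dim_eq_five_of_fourfolds`; Tankeev's
prime-dimension theorem for SIMPLE fivefolds, cited by Markman («[Ta]»), is not consumed: Thm. 0.2 (iv) already puts
`B²` of a fivefold without fourfold factor inside `D²`). Versus the sibling's
`hodgeConjectureFor_dim_le_five_of_weilAlgebraicAll_two`: its binder `hMZ` (the combined SENTENCE) is, in the tree,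
`…_of_codimTwoFacts h01 h02`; here the two printed theorems are the binders. Delta (Δ1) named in the module
docstring (codimension-2 slices: WEAKER-OR-EQUAL hypotheses than print). CONDITIONAL on `h01`, `h02` (refereed,
unproved in the tree) and on the displayed hypothesis (PREPRINT claim in general); no case of HC is proved here.
[cite: MoonenZarhin1999LowDim, Thm. 0.1 (arXiv from p. 1) and Thm. 0.2 (arXiv from p. 2) with (1.9), (2.7) (arXiv v2 numbering; (1.9) = (1.8) of v1, (2.7) in both)]
[cite: Voisin2026BourbakiMarkman, Thm. 2.6 and Cor. 2.8 (p. 15)]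
[cite: Markman2025SurveySecant, §1.1 reduction paragraph and Cor. 1.3 (arXiv v2 p. 3 L38–47); Abstract (p. 1 L35–37)] -/
theorem hodgeConjectureFor_dim_le_five_of_weilAlgebraicAll_two_of_moonenZarhin
    (h01 : MoonenZarhin1999_codimTwoHodgeClasses_abelianFourfold)
    (h02 : MoonenZarhin1999_codimTwoHodgeClasses_abelianFivefold)
    (hW₄ : ∀ d : ℕ, 0 < d → WeilAlgebraicAll 2 d) (A : AbelianVariety ℂ) (hd : A.dim ≤ 5) :
    HodgeConjectureFor A.dim A.X :=
  hcUpToDim_five_of_codimTwoFacts_of_weilClassesFourfolds h01 h02 (weilAlgebraicAll_two_iff_markman.1 hW₄) A hd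

/-- **(B3-b from split SIXFOLDS, AS PRINTED end to end) — Voisin, Exp. 1248 Cor. 2.10 (p. 16): «… Elle entraîne
donc également la conjecture de Hodge pour les variétés abéliennes de dimension ≤ 5 par le corollaire 2.8»; Markman,
arXiv:2509.23403v2 Abstract (p. 1 L35–37): «… the algebraicity of the Weil classes on abelian sixfolds of split Weil
type. The algebraicity of the Weil classes on all abelian fourfold of Weil type follows. The Hodge conjecture for
abelian varieties of dimension ≤ 5 is known to follow from the latter result.» — modulo EXACTLY Thms. 0.1/0.2
(codimension-2 parts) BY NAME.** HYPOTHESIS = Thm. 1.5.1 per `d` (`∀ d ≥ 1, Stubs.WeilAlgebraicSplitHyperplane 3 d`);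
Schoen degeneration = kernel theorem `weilAlgebraicAll_two_of_splitSixfolds`; then
`hodgeConjectureFor_dim_le_five_of_weilAlgebraicAll_two_of_moonenZarhin`. CONDITIONAL on `h01`, `h02` and Thm. 1.5.1
(PREPRINT); no case of HC is proved here. [cite: Voisin2026BourbakiMarkman, Cor. 2.8 (p. 15) and Cor. 2.10 (p. 16)]
[cite: Markman2025SurveySecant, Abstract (p. 1 L35–37), Thm. 1.2 and Cor. 1.3 (p. 3)]
[cite: Markman2025SecantWeil, Thm. 1.5.1 (arXiv v2 p. 9 L7–13)]
[cite: MoonenZarhin1999LowDim, Thm. 0.1 and Thm. 0.2 (arXiv:math/9901113 pp. 1–3)] [cite: Schoen1998HodgeWeilAddendum, 10 (Proposition), p. 332] -/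
theorem hodgeConjectureFor_dim_le_five_of_splitSixfolds_of_moonenZarhin
    (h01 : MoonenZarhin1999_codimTwoHodgeClasses_abelianFourfold)
    (h02 : MoonenZarhin1999_codimTwoHodgeClasses_abelianFivefold)
    (hW₆ : ∀ d : ℕ, 0 < d → WeilAlgebraicSplitHyperplane 3 d) (A : AbelianVariety ℂ) (hd : A.dim ≤ 5) :
    HodgeConjectureFor A.dim A.X :=
  hodgeConjectureFor_dim_le_five_of_weilAlgebraicAll_two_of_moonenZarhin h01 h02
    (fun d hd' ↦ weilAlgebraicAll_two_of_splitSixfolds hd' (hW₆ d hd')) A hd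

/-! ### The door is two-sided: on-path converse (unconditional) and exactness modulo Moonen–Zarhin -/

/-- **ON-PATH converse, UNCONDITIONAL: HC for complex abelian fourfolds gives back the displayed Weil-class
hypothesis of scopes (a)/(b)** — Weil classes are rational Hodge classes of type `(2,2)` (Moonen–Zarhin (1.9), arXiv v2
numbering = the tree's fact files' «(1.9)»; = (1.8) of arXiv v1: «either
W_K consists entirely of Hodge classes or 0 ∈ W_K is the only Hodge class in W_K»; Deligne, LNM 900 Prop. 4.4), so
`HodgeConjectureFor` at dimension 4 makes them algebraic. Recorded so that the cell's books show (B3-a/b) as a DOOR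
(the Weil-fourfold statement is a CASE of HC, on-path), exactly as the sibling records (c) two-sidedly at CM points.
Carrier: ring 2's `Ring2.ClassTargets.weilClassesFourfolds_of_hcAtDim_four` + the kernel dictionary. An implication
OUT of HC at dimension 4; no case of HC is proved. [cite: MoonenZarhin1999LowDim, (1.9) (arXiv v2 numbering; = (1.8) of v1)]
[cite: Deligne1982HodgeCycles, §4 Prop. 4.4] [cite: Markman2025SecantWeil, Cor. 1.6.1] -/
theorem weilAlgebraicAll_two_of_hodgeConjectureFor_dim_four
    (h : ∀ A : AbelianVariety ℂ, A.dim = 4 → HodgeConjectureFor A.dim A.X) (d : ℕ) (hd : 0 < d) :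
    WeilAlgebraicAll 2 d :=
  weilAlgebraicAll_two_iff_markman.2 (weilClassesFourfolds_of_hcAtDim_four h) d hd

/-- **EXACTNESS of (B3-b) modulo Moonen–Zarhin: granted Thms. 0.1/0.2 (codimension-2 parts) BY NAME, HC for complex
abelian varieties of dimension `≤ 5` is EQUIVALENT to the displayed Weil-fourfold hypothesis** — the printed
reduction loses nothing («in the cases (a), (b) and (c) the Weil classes are really needed to generate the Hodge
ring; in these cases we have D²(X) ≠ B²(X)», printed between Thms. (0.1) and (0.2) (arXiv:math/9901113 pp. 1–2; store text p0001.txt L123–125), is the printed remark that the hypothesis is not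
idle). Carrier: ring 2's `Ring2.ClassTargets.hcUpToDim_five_iff_weilClassesFourfolds` in the cell's currency. For the
cell's accounting only: what an object proving fourfold (or split-sixfold) Weil classes buys through (B3-a/b) is
EXACTLY HC in dimension `≤ 5`, modulo the two refereed facts — and nothing in dimension `≥ 6` (delta (Δ3)). No case
of HC is proved (an `↔` between open statements under named facts).
[cite: MoonenZarhin1999LowDim, Thm. 0.1, Thm. 0.2 and the remark after Thm. 0.1 (arXiv:math/9901113 pp. 1–3)]
[cite: Voisin2026BourbakiMarkman, Thm. 2.6 and Cor. 2.8 (p. 15)] [cite: Markman2025SurveySecant, Cor. 1.3] -/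
theorem hodgeConjectureFor_dim_le_five_iff_weilAlgebraicAll_two_of_moonenZarhin
    (h01 : MoonenZarhin1999_codimTwoHodgeClasses_abelianFourfold)
    (h02 : MoonenZarhin1999_codimTwoHodgeClasses_abelianFivefold) :
    (∀ A : AbelianVariety ℂ, A.dim ≤ 5 → HodgeConjectureFor A.dim A.X) ↔ ∀ d : ℕ, 0 < d → WeilAlgebraicAll 2 d :=
  (hcUpToDim_five_iff_weilClassesFourfolds h01 h02).trans weilAlgebraicAll_two_iff_markman.symm

end Summit.Ventures.HSemireg.S4Bridge

end
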